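import Summits.BirchSwinnertonDyer.BirchSwinnertonDyer.Theorems.Rank1ResidualJetDefs
import Summits.BirchSwinnertonDyer.BirchSwinnertonDyer.Theorems.Rank1ResidualX9JetchevCha
import Summits.BirchSwinnertonDyer.Rank1Residual.X11b.KolyvaginBottomPoint
import Summits.BirchSwinnertonDyer.Rank1Residual.X11b.Three.KolyvaginLine
import Literature.NumberTheory.EllipticCurves.HeegnerPointsOfConductorOneData
import Literature.NumberTheory.EllipticCurves.HeegnerPointsKolyvaginPrimaryGeneratorProofs
import Literature.NumberTheory.EllipticCurves.KolyvaginShaStructureDivisibility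
import Literature.NumberTheory.EllipticCurves.Rank1Residual.Typed.KolyvaginCertificate
import Literature.NumberTheory.EllipticCurves.Rank1Residual.X10bMatarNekovarIndexBound
import Literature.NumberTheory.EllipticCurves.BSDSelmerCMPConverseHeegnerFieldProofs
import Literature.NumberTheory.EllipticCurves.BSDSelmerSkinnerProofs
import Literature.NumberTheory.EllipticCurves.NonEisensteinPrimeOfSurjective
import Literature.NumberTheory.EllipticCurves.ZywinaCMImageProofs
import Literature.NumberTheory.EllipticCurves.Kato2004.ThreeAdicFrobeniusCertificate
import HarnessLib

/-!
# T1 JET (cell `bsd-jet`), bucket B-add (`q = p = 3`, `E` ADDITIVE at `3`, Kodaira IV/IV*, `c₃ = 3`):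
# the Tamagawa-sharpened Heegner-index certificate through the READING binder
# `JetchevDivisibilityCarrierAdd` — the flag-free twin of `bsdp_of_millerJetchev_of_index_le_tamagawa`
# on the additive-carrier cells, PROVED modulo named inputs (companion of `Rank1ResidualJetCarrierMult.lean`)

HONEST FRAMING (programme file `BSD-LIT2PART-PROGRAMME-v1.md` §HONESTY, verbatim): «no tranche here
proves BSD; ARM L moves the LITERAL column of an r ≤ 1 census into the kernel-proved-modulo-named-print
column; ARM P changes what «named print» is worth.» THEOREMS ONLY (seat `bsd-jet-pv-2`, session g2;
`--supports stmt-BirchSwinnertonDyer-14418 --as helper`). CONDITIONAL on the READING binder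
`hJ : JET.JetchevDivisibilityCarrierAdd` (`Rank1ResidualJetDefs.lean`: Jetchev 2008 Thm. 1.4 read at a
carrier `q = p` with `E` ADDITIVE at `p` — NOT a published statement; audit sheet
`HOME/sheets/PV2-B-GAP.md` + addendum `PV2-BADD-GAP.md`; referee C's word pending) and on PUBLISHED
named facts (McCallum Cor. 5.6 `hMcU`, Kolyvagin `hKo`, GZK `hGZK`, Shimura reciprocity `hrec`, Darmon
3.6 `hD36`, Carayol `hlev`). Nothing is booked; 0 classes move by this file; the `JET@p∣N` flag on these
rows is referee A's word on the reading.

WHY A THIRD FILE. The census of record (`HOME/census-jet/jet_keys_B_classes.tsv` 4c8599cf93bc5459)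
has 73 456 bucket-B cells (carrier `q = p`): 54 232 with `p` split multiplicative (`I_n`, `p ∣ n`; the
binder `JetchevDivisibilityCarrierMult`, file `Rank1ResidualJetCarrierMult.lean`) and **19 224 with
`p = 3` and `E` ADDITIVE at `3`** (Kodaira IV: 7 753, IV*: 11 471; `c₃ = 3 = #Φ₃(𝔽₃)`), which the
multiplicative binder does not cover (`3` is the only odd prime dividing the Tamagawa number of an
additive fibre). This file is `Rank1ResidualJetCarrierMult.lean` with «multiplicative at `p`» replaced
by «additive at `p`» (`¬ good ∧ ¬ multiplicative`, the cell predicate `Addv` unfolded) in every binder,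
and with two differences of substance: (i) non-CM no longer comes from the reduction type but from
`ρ̄_{E,p}` onto at odd `p` (`not_hasSurjectiveModNGaloisRep_of_hasCM`, Zywina 2015), as in the bucket-A
file; (ii) the `p`-adic tower is NOT discharged from mod-`p` surjectivity (false in general at an
additive `3`, Elkies 2006): §4 keeps it as a binder (`…_level`) or discharges it at `p = 3` from ONE
Frobenius witness modulo `9` (`…_level_three_of_frobenius`,
`WeierstrassCurve.forall_hasSurjectiveModNGaloisRep_three_pow_of_frobenius`). The reading behind `hJ`:
«`p ∤ N`» enters Jetchev's proof only through Lemma 4.3 inside Prop. 4.9 at the stringent places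
`v ∣ p`; Lemma 4.3 is FALSE at an additive `v ∣ p` (`Ẽ_ns = 𝔾_a` is `p`-torsion) and is REPLACED by
the x11b3 tree theorem `X11b.Three.JetchevKummer.localKummerMap_mem_connectedKummerCondition_of_cocycle_of_hasAdditiveReduction`
(single entry `…_padic_of_cocycle_of_not_hasGoodReductionAtPrime`, `X11b/Three/BadPlaceKummer.lean`)
modulo [GZ86, III (3.1)]; the local quotient of Thm. 6.3 at `v ∣ 3` is `Φ_v(𝔽₃) ≅ ℤ/3` (IV/IV*);
§§5–6 are carrier-blind (kernel: `Rank1ResidualJetSection6.lean`).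

* §1 `padicValNat_card_sha_primary_add_le_of_carrierAdd_of_mcCallum` — `hJ` ∘ McCallum Cor. 5.6
  (frame currency): `ord_p #Ш(E/K)[p^∞] + 2·ord_p c_p ≤ 2·M₀`.
* §2 `sha_card_add_tamagawa_le_index_of_carrierAdd` (`IsHeegnerPoint` currency) and
  `shaOrder_add_tamagawa_le_index_of_carrierAdd` (over `ℚ`: EXACTLY `hMJ`'s conclusion at `q = p`).
* §3 `noPTorsion_of_carrierAddCertificate`, `bsdp_of_carrierAddCertificate` — the certificate case.
* §4 `bsdp_of_carrierAddCertificate_level` (rows' shape, any stated level `N`, tower as input) and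
  `bsdp_of_carrierAddCertificate_level_three_of_frobenius` (`p = 3`, tower from the mod-`9` witness).

References: [Jetchev2008] Thm. 1.4, Cor. 1.5 (p. 812), Lemma 4.3 (p0009), Prop. 4.9 (p0012–p0013),
Thm. 6.3 (p0015); [McCallumLMS1991] §5 Lemma 5.1 (p. 303), Cor. 5.6 (p. 310); [GrossLMS1991] Thm. 1.3,
Prop. 6.2 (1) (p. 245), §4 (4.1); [Darmon2004] Thm. 3.6–3.7; [Miller2011LMS] Def. 1.1, Thm. 5.4;
[Zywina2015] Prop. 1.14/1.16; [Elkies2006] Introduction; [Kato2004Asterisque] (12.5.2);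
[SerreAbelianLadic1968] IV-23; [DiamondShurman2005] Thm. 8.8.1.
-/

noncomputable section

open scoped Classical

open WeierstrassCurve Literature.NumberTheory.EllipticCurves
  Literature.NumberTheory.EllipticCurves.ModularForms
  Literature.NumberTheory.EllipticCurves.Rank1Residual
  Summit.BirchSwinnertonDyer.Rank1Residual Summit.BirchSwinnertonDyer.Rank1Residual.X11b

namespace Summit.BirchSwinnertonDyer.Rank1Residual.JET

/-! ### §1 Frame currency over `K`: the reading binder ∘ McCallum Cor. 5.6 (upper form) -/

/-- **Cor. 1.5 over `K` with carrier `p` additive (frame currency).** Under the binders of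
`JetchevDivisibilityCarrierAdd` (`hJ`, READING — not published) and
`McCallum1991_padicValNat_card_sha_primary_add_le_of_globalDivisibility` (`hMcU`, published): `W/ℚ`
globally minimal, `p ≠ 2` of ADDITIVE reduction (non-CM from `ρ̄_{E,p}` onto at odd `p`, `not_hasSurjectiveModNGaloisRep_of_hasCM`)
with `ρ̄_{E,p^n}` onto for all `n`; `K` imaginary quadratic Heegner for `N = W.conductorNorm ℤ`,
`d_K ∉ {−3, −4}`; a frame `(Dt, β, ι)` with a conductor-`1` datum `d₁` whose derived point is `P ∈ E(K)`
in `E(K̄)`, `P` of infinite order, `p^{M₀} ∥ P`. CONCLUSION: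
`ord_p #Ш(E/K)[p^∞] + 2·ord_p c_p(E) ≤ 2·M₀`. CONDITIONAL on `hJ` and `hMcU`.
[cite: Jetchev2008, Cor. 1.5 (p. 812)] [cite: McCallumLMS1991, §5 Cor. 5.6 (p. 310) and Lemma 5.1 (p. 303)] -/
theorem padicValNat_card_sha_primary_add_le_of_carrierAdd_of_mcCallum
    (hJ : JetchevDivisibilityCarrierAdd)
    (hMcU : McCallum1991_padicValNat_card_sha_primary_add_le_of_globalDivisibility)
    (W : WeierstrassCurve ℚ) [W.IsElliptic] [W.IsGloballyMinimal] [NeZero (W.conductorNorm ℤ)]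
    (K : Type) [Field K] [NumberField K] (hK : IsImaginaryQuadratic K)
    (hD3 : NumberField.discr K ≠ -3) (hD4 : NumberField.discr K ≠ -4)
    (hH : SatisfiesHeegnerHypothesis (W.conductorNorm ℤ) K)
    (p : ℕ) [Fact p.Prime] (hp2 : p ≠ 2) (hng : ¬ W.HasGoodReductionAtPrime p)
    (hnm : ¬ W.HasMultiplicativeReductionAtPrime p)
    (htower : ∀ n : ℕ, W.HasSurjectiveModNGaloisRep (p ^ n : ℕ))
    (Dt : ModularParametrizationData W (W.conductorNorm ℤ)) (β : ℤ) (ι : K →+* ℂ)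
    (d₁ : KolyvaginHeegnerData Dt β ι 1) (P : (W.baseChange K).toAffine.Point)
    (hPd : d₁.toGeomPoints d₁.derivedPoint = toGeomPoints (W.baseChange K) P)
    (hnt : ¬ IsOfFinAddOrder P) (M₀ : ℕ)
    (hdiv : ∃ Q : (W.baseChange K).toAffine.Point, ((p ^ M₀ : ℕ) : ℤ) • Q = P)
    (hndiv : ¬ ∃ Q : (W.baseChange K).toAffine.Point, ((p ^ (M₀ + 1) : ℕ) : ℤ) • Q = P) :
    padicValNat p (Nat.card (AddCommGroup.primaryComponent (W.baseChange K).sha p)) +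
        2 * padicValNat p ((W.baseChange ℚ_[p]).localTamagawaNumber ℤ_[p]) ≤ 2 * M₀ := by
  -- no CM: `ρ̄_{E,p}` onto at an odd prime (Zywina 2015 Prop. 1.14/1.16; Serre 1972 §4.5)
  have hsurj : W.HasSurjectiveModNGaloisRep (p : ℤ) := by simpa using htower 1
  have hcm : ¬ W.HasCM := fun hCM ↦
    W.not_hasSurjectiveModNGaloisRep_of_hasCM hCM (Fact.out : p.Prime) hp2 (by simpa using hsurj)
  -- `P_1` has infinite order since `P` has (same image in `E(K̄)`, injective maps)
  have hy₁ : ¬ IsOfFinAddOrder d₁.derivedPoint := by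
    intro hfin
    apply hnt
    have h1 : IsOfFinAddOrder (d₁.toGeomPoints d₁.derivedPoint) :=
      d₁.toGeomPoints.isOfFinAddOrder hfin
    rw [hPd] at h1
    exact (toGeomPoints_injective (W.baseChange K)).isOfFinAddOrder_iff.mp h1
  exact hMcU W hcm K hK hD3 hD4 hH p hp2 htower Dt β ι d₁ P hPd hnt M₀ hdiv hndiv
    (padicValNat p ((W.baseChange ℚ_[p]).localTamagawaNumber ℤ_[p]))
    (fun s hs n d hn hℓ ↦ hJ W hcm K hK hD3 hD4 hH p hp2 hng hnm htower Dt β ι d₁ hy₁ s hs n d hn hℓ)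

/-! ### §2 `IsHeegnerPoint` currency over `K`: the sharpened index bound for the row's Heegner point -/

/-- **The sharpened bound `ord_p #Ш(E/K) + 2·ord_p c_p ≤ 2·ord_p [E(K):ℤP]` for the row's Heegner
point, carrier `p` additive.** Binders: `hJ` (READING), `hMcU` (McCallum Cor. 5.6), `hKo`
(Kolyvagin: rank one, `Ш(E/K)` finite), `hrec` (Shimura reciprocity at conductor `1`: the bottom point
of a conductor-`1` datum is `y_K`), `hD36` (Darmon 2004 Thm. 3.6: the conductor-`1` datum exists) —
all PUBLISHED but `hJ`. Data: `W/ℚ` globally minimal, `K` Heegner for `N = W.conductorNorm ℤ` with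
`d_K ∉ {−3, −4}`, `P` a Heegner point of infinite order, `p ≠ 2` additive with the `p`-adic tower.
Steps: the frame of `P` and a conductor-`1` datum on it (`KolyvaginBottom.exists_frame_of_isHeegnerPoint`,
`exists_kolyvaginHeegnerData_one`); `p^{M₀} ∥ P` (Mordell–Weil, `exists_pow_smul_eq_and_forall_ne`);
§1; `ord_p #Ш = ord_p #Ш[p^∞]`; `ord_p [E(K):ℤP] = M₀` (McCallum Lemma 5.1 on tree objects,
`Koly.padicValNat_index_zmultiples_eq_of_divisibility`, `E(K)[p] = 0` from irreducibility over the
quadratic `K`). CONDITIONAL on `hJ` and the facts. [cite: Jetchev2008, Cor. 1.5 (p. 812)]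
[cite: McCallumLMS1991, §5 Lemma 5.1 (p. 303) and Cor. 5.6 (p. 310)] [cite: GrossLMS1991, §4 (4.1) and Thm. 1.3]
[cite: Darmon2004, Thm. 3.6 (PDF p. 43)] -/
theorem sha_card_add_tamagawa_le_index_of_carrierAdd
    (hJ : JetchevDivisibilityCarrierAdd)
    (hMcU : McCallum1991_padicValNat_card_sha_primary_add_le_of_globalDivisibility)
    (W : WeierstrassCurve ℚ) [W.IsElliptic] [W.IsGloballyMinimal] [NeZero (W.conductorNorm ℤ)]
    (K : Type) [Field K] [NumberField K]
    (hKo : kolyvagin (W.conductorNorm ℤ) W K)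
    (hrec : heegnerPointOfConductor_one_galoisConj (W.conductorNorm ℤ) W K)
    (hD36 : phi_heegnerTau_mem_singularModuliField (W.conductorNorm ℤ) W K)
    (hK : IsImaginaryQuadratic K) (hD3 : NumberField.discr K ≠ -3) (hD4 : NumberField.discr K ≠ -4)
    (hH : SatisfiesHeegnerHypothesis (W.conductorNorm ℤ) K)
    (p : ℕ) [Fact p.Prime] (hp2 : p ≠ 2) (hng : ¬ W.HasGoodReductionAtPrime p)
    (hnm : ¬ W.HasMultiplicativeReductionAtPrime p)
    (htower : ∀ n : ℕ, W.HasSurjectiveModNGaloisRep (p ^ n : ℕ))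
    {P : (W.baseChange K).toAffine.Point} (hP : IsHeegnerPoint (W.conductorNorm ℤ) W K P)
    (hnt : ¬ IsOfFinAddOrder P) :
    padicValNat p (Nat.card (W.baseChange K).sha) +
        2 * padicValNat p ((W.baseChange ℚ_[p]).localTamagawaNumber ℤ_[p]) ≤
      2 * padicValNat p (AddSubgroup.zmultiples P).index := by
  have hp : p.Prime := Fact.out
  -- rank one and finiteness of `Ш(E/K)` (Kolyvagin)
  obtain ⟨hrank, hfinK⟩ := hKo hK hH hP hnt
  haveI : Finite (W.baseChange K).sha := hfinK
  -- the frame of the Heegner point and a conductor-1 datum on it with bottom point `P`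
  obtain ⟨Dt, β, ι, hβ, hall⟩ := KolyvaginBottom.exists_frame_of_isHeegnerPoint hrec hK hH hP
  obtain ⟨d₁⟩ := exists_kolyvaginHeegnerData_one hD36 hK Dt β ι hβ
  -- the exponent `p^{M₀} ∥ P` (Mordell–Weil)
  haveI : Module.Finite ℤ (W.baseChange K).toAffine.Point := (W.baseChange K).module_finite_point_holds
  obtain ⟨M₀, x₀, hx₀, hmax⟩ := exists_pow_smul_eq_and_forall_ne hnt (p := p) hp.two_le
  have hdiv : ∃ Q : (W.baseChange K).toAffine.Point, ((p ^ M₀ : ℕ) : ℤ) • Q = P :=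
    ⟨x₀, by rw [natCast_zsmul]; exact hx₀⟩
  have hndiv : ¬ ∃ Q : (W.baseChange K).toAffine.Point, ((p ^ (M₀ + 1) : ℕ) : ℤ) • Q = P := by
    rintro ⟨Q, hQ⟩
    exact hmax Q (by rw [← natCast_zsmul]; exact hQ)
  -- §1
  have hle := padicValNat_card_sha_primary_add_le_of_carrierAdd_of_mcCallum hJ hMcU W K hK hD3 hD4 hH
    p hp2 hng hnm htower Dt β ι d₁ P (hall d₁) hnt M₀ hdiv hndiv
  -- `ord_p #Ш = ord_p #Ш[p^∞]`
  have hsha : padicValNat p (Nat.card (AddCommGroup.primaryComponent (W.baseChange K).sha p)) =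
      padicValNat p (Nat.card (W.baseChange K).sha) :=
    padicValNat_card_addPrimaryComponent (A := (W.baseChange K).sha) p
  -- no `p`-torsion in `E(K)` (irreducibility of `E[p]` from mod-`p` surjectivity, `K` quadratic)
  haveI : NeZero (p : ℚ) := ⟨Nat.cast_ne_zero.mpr hp.ne_zero⟩
  have hsurj : W.HasSurjectiveModNGaloisRep (p : ℤ) := by simpa using htower 1
  have hirr : W.HasIrreducibleModPGaloisRep p :=
    hasIrreducibleModPGaloisRep_of_hasSurjectiveModNGaloisRep W p (by simpa using hsurj)
  have hbot := torsionBy_eq_bot_of_isImaginaryQuadratic_of_hasIrreducibleModPGaloisRep W K hK hp hirr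
  have hiv : ∀ x : (W.baseChange K).toAffine.Point, p • x = 0 → x = 0 := fun x hx ↦ by
    have hmem : x ∈ AddSubgroup.torsionBy (W.baseChange K).toAffine.Point ((p : ℕ) : ℤ) := by
      rw [mem_torsionBy_iff, natCast_zsmul]
      exact hx
    rw [hbot] at hmem
    exact hmem
  -- `ord_p [E(K):ℤP] = M₀` (McCallum Lemma 5.1)
  haveI : Finite (AddCommGroup.torsion (W.baseChange K).toAffine.Point) :=
    WeierstrassCurve.finite_torsion_point (W := W.baseChange K)
  obtain ⟨c, Q, hcQ, hcker⟩ := RankOne.exists_coord_of_mordellWeilRank_eq_one (W.baseChange K) hrank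
  have hidx : padicValNat p (AddSubgroup.zmultiples P).index = M₀ :=
    Three.Koly.padicValNat_index_zmultiples_eq_of_divisibility c Q hcQ hcker hiv P hdiv hndiv
  rw [hidx, ← hsha]
  exact hle

/-- **The OVER-`ℚ` shape at `q = p`** — exactly the conclusion of
`Miller2011.thm54_cha_padicValNat_shaOrder_add_tamagawa_le` (the flagged `hMJ`) for the carrier `p`:
`ord_p #Ш(E/ℚ) + 2·ord_p c_p(E) ≤ 2·ord_p [E(K):ℤP]`, from §2 and `ord_p #Ш(E/ℚ) ≤ ord_p #Ш(E/K)`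
(odd `p`, `padicValNat_shaOrder_le_baseChange_of_odd`). CONDITIONAL on `hJ` and the facts.
[cite: Miller2011LMS, Thm. 5.4 (arXiv:1010.2431 p. 11)] [cite: Jetchev2008, Cor. 1.5 (p. 812)]
[cite: SerreGaloisCohomology1997, I.§2.4 Cor. to Prop. 9] -/
theorem shaOrder_add_tamagawa_le_index_of_carrierAdd
    (hJ : JetchevDivisibilityCarrierAdd)
    (hMcU : McCallum1991_padicValNat_card_sha_primary_add_le_of_globalDivisibility)
    (W : WeierstrassCurve ℚ) [W.IsElliptic] [W.IsGloballyMinimal] [NeZero (W.conductorNorm ℤ)]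
    (K : Type) [Field K] [NumberField K]
    (hKo : kolyvagin (W.conductorNorm ℤ) W K)
    (hrec : heegnerPointOfConductor_one_galoisConj (W.conductorNorm ℤ) W K)
    (hD36 : phi_heegnerTau_mem_singularModuliField (W.conductorNorm ℤ) W K)
    (hK : IsImaginaryQuadratic K) (hD3 : NumberField.discr K ≠ -3) (hD4 : NumberField.discr K ≠ -4)
    (hH : SatisfiesHeegnerHypothesis (W.conductorNorm ℤ) K)
    (p : ℕ) [Fact p.Prime] (hp2 : p ≠ 2) (hng : ¬ W.HasGoodReductionAtPrime p)
    (hnm : ¬ W.HasMultiplicativeReductionAtPrime p)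
    (htower : ∀ n : ℕ, W.HasSurjectiveModNGaloisRep (p ^ n : ℕ))
    {P : (W.baseChange K).toAffine.Point} (hP : IsHeegnerPoint (W.conductorNorm ℤ) W K P)
    (hnt : ¬ IsOfFinAddOrder P) :
    padicValNat p W.shaOrder + 2 * padicValNat p ((W.baseChange ℚ_[p]).localTamagawaNumber ℤ_[p]) ≤
      2 * padicValNat p (AddSubgroup.zmultiples P).index := by
  obtain ⟨-, hfinK⟩ := hKo hK hH hP hnt
  have hK' := sha_card_add_tamagawa_le_index_of_carrierAdd hJ hMcU W K hKo hrec hD36 hK hD3 hD4 hH p hp2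
    hng hnm htower hP hnt
  have hQK := padicValNat_shaOrder_le_baseChange_of_odd W K hK p hp2 (shaFinite_of_baseChange W K hfinK)
    hfinK
  omega

/-! ### §3 The certificate case: `Ш(E/ℚ)[p] = 0` and `BSD(E,p)` -/

/-- **The bucket-B certificate `ord_p [E(K):ℤP] ≤ ord_p c_p(E)` gives `Ш(E/ℚ)[p] = 0`** (data as in
§2; GZK `hGZK` for the finiteness of `Ш(E/ℚ)` in analytic rank `≤ 1`): §2 over `ℚ` and the certificate
give `ord_p #Ш(E/ℚ) = 0`, hence no element of order `p` (`Typed.noPTorsion_of_padicValNat_shaOrder_eq_zero`).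
CONDITIONAL on `hJ` and the facts. [cite: Jetchev2008, Cor. 1.5 (p. 812)] [cite: Miller2011LMS, Def. 1.1] -/
theorem noPTorsion_of_carrierAddCertificate
    (hJ : JetchevDivisibilityCarrierAdd)
    (hMcU : McCallum1991_padicValNat_card_sha_primary_add_le_of_globalDivisibility)
    (hGZK : rank_eq_analyticRank_of_analyticRank_le_one)
    (W : WeierstrassCurve ℚ) [W.IsElliptic] [W.IsGloballyMinimal] [NeZero (W.conductorNorm ℤ)]
    (K : Type) [Field K] [NumberField K]
    (hKo : kolyvagin (W.conductorNorm ℤ) W K)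
    (hrec : heegnerPointOfConductor_one_galoisConj (W.conductorNorm ℤ) W K)
    (hD36 : phi_heegnerTau_mem_singularModuliField (W.conductorNorm ℤ) W K)
    (hK : IsImaginaryQuadratic K) (hD3 : NumberField.discr K ≠ -3) (hD4 : NumberField.discr K ≠ -4)
    (hH : SatisfiesHeegnerHypothesis (W.conductorNorm ℤ) K)
    (p : ℕ) [Fact p.Prime] (hp2 : p ≠ 2) (hng : ¬ W.HasGoodReductionAtPrime p)
    (hnm : ¬ W.HasMultiplicativeReductionAtPrime p)
    (htower : ∀ n : ℕ, W.HasSurjectiveModNGaloisRep (p ^ n : ℕ))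
    {P : (W.baseChange K).toAffine.Point} (hP : IsHeegnerPoint (W.conductorNorm ℤ) W K P)
    (hnt : ¬ IsOfFinAddOrder P)
    (hI : padicValNat p (AddSubgroup.zmultiples P).index ≤
      padicValNat p ((W.baseChange ℚ_[p]).localTamagawaNumber ℤ_[p]))
    (hr : W.analyticRank ≤ 1) : ∀ x : W.sha, (p : ℤ) • x = 0 → x = 0 := by
  have hb := shaOrder_add_tamagawa_le_index_of_carrierAdd hJ hMcU W K hKo hrec hD36 hK hD3 hD4 hH p hp2
    hng hnm htower hP hnt
  have h0 : padicValNat p W.shaOrder = 0 := by omega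
  exact Typed.noPTorsion_of_padicValNat_shaOrder_eq_zero W p (hGZK W hr).2 h0

/-- **`BSD(E,p)` from the bucket-B-add certificate at a pair with `p ∤ #Ш_an`** (analytic rank `≤ 1`):
the flag-free-modulo-reading twin of `bsdp_of_millerJetchev_of_index_le_tamagawa` at the carrier
`q = p`: `hMJ` replaced by `hJ : JetchevDivisibilityCarrierAdd` + McCallum Cor. 5.6 + Kolyvagin +
Shimura reciprocity + Darmon 3.6 + GZK. Certificate: `W` globally minimal, `K` Heegner for `N_E` with
`d_K ∉ {−3,−4}`, `P` a Heegner point of infinite order, `p` odd ADDITIVE with the `p`-adic tower (an INPUT: at an additive `3` it does not follow from mod-`3` surjectivity),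
`ord_p [E(K):ℤP] ≤ ord_p c_p(E)`, `r_an ≤ 1`, `#Ш_an = s` with `ord_p s = 0`. PER PAIR; books nothing
(the flag is referee A's). CONDITIONAL on `hJ` and the facts.
[cite: Jetchev2008, Thm. 1.4 and Cor. 1.5 (p. 812)] [cite: Miller2011LMS, Thm. 5.4 and Def. 1.1] -/
theorem bsdp_of_carrierAddCertificate
    (hJ : JetchevDivisibilityCarrierAdd)
    (hMcU : McCallum1991_padicValNat_card_sha_primary_add_le_of_globalDivisibility)
    (hGZK : rank_eq_analyticRank_of_analyticRank_le_one)
    (W : WeierstrassCurve ℚ) [W.IsElliptic] [W.IsGloballyMinimal] [NeZero (W.conductorNorm ℤ)]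
    (K : Type) [Field K] [NumberField K]
    (hKo : kolyvagin (W.conductorNorm ℤ) W K)
    (hrec : heegnerPointOfConductor_one_galoisConj (W.conductorNorm ℤ) W K)
    (hD36 : phi_heegnerTau_mem_singularModuliField (W.conductorNorm ℤ) W K)
    (hK : IsImaginaryQuadratic K) (hD3 : NumberField.discr K ≠ -3) (hD4 : NumberField.discr K ≠ -4)
    (hH : SatisfiesHeegnerHypothesis (W.conductorNorm ℤ) K)
    (p : ℕ) [Fact p.Prime] (hp2 : p ≠ 2) (hng : ¬ W.HasGoodReductionAtPrime p)
    (hnm : ¬ W.HasMultiplicativeReductionAtPrime p)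
    (htower : ∀ n : ℕ, W.HasSurjectiveModNGaloisRep (p ^ n : ℕ))
    {P : (W.baseChange K).toAffine.Point} (hP : IsHeegnerPoint (W.conductorNorm ℤ) W K P)
    (hnt : ¬ IsOfFinAddOrder P)
    (hI : padicValNat p (AddSubgroup.zmultiples P).index ≤
      padicValNat p ((W.baseChange ℚ_[p]).localTamagawaNumber ℤ_[p]))
    (hr : W.analyticRank ≤ 1) {s : ℚ} (hs : shaAn W = (s : ℂ)) (hv : padicValRat p s = 0) :
    BSDp W p :=
  Typed.bsdp_of_shaAn_unit_of_noPTorsion W p hGZK hr hs hv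
    (noPTorsion_of_carrierAddCertificate hJ hMcU hGZK W K hKo hrec hD36 hK hD3 hD4 hH p hp2 hng hnm htower
      hP hnt hI hr)

/-! ### §4 The rows' shapes: any stated level `N` (tower as input), and `p = 3` with the tower from the mod-`9` Frobenius certificate -/

/-- **`BSD(E,p)` from the bucket-B-add certificate at a Heegner datum of ANY stated level `N`, the
`p`-adic tower as an INPUT** — the binder shape of the register rows (`IsHeegnerPoint N W K P`,
`SatisfiesHeegnerHypothesis N K`, as in `JET.bsdp_of_jetIndexRow`): the datum inside
`IsHeegnerPoint N W K P` carries a newform of level `N` for `W`, so `N = W.conductorNorm ℤ` by Carayol's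
theorem (named fact `IsNewformOf.level_eq_conductorNorm`, `hlev`; Diamond–Shurman Thm. 8.8.1), and
`bsdp_of_carrierAddCertificate` applies. At an ADDITIVE `p` the tower `∀ n, ρ̄_{E,p^n}` onto does NOT
follow from `ρ̄_{E,p}` onto (`p = 3`: Elkies 2006), so it stays a binder here; `…_level_three_of_frobenius`
discharges it from the mod-`9` certificate. The published binders `hKo`, `hrec`, `hD36` are taken in
their `∀ N W K` form, as in the siblings. CONDITIONAL on the reading binder `hJ` and every published
binder. [cite: Jetchev2008, Cor. 1.5 (p. 812)] [cite: DiamondShurman2005, Thm. 8.8.1]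
[cite: Elkies2006, Introduction (p. 1)] [cite: Miller2011LMS, Def. 1.1] -/
theorem bsdp_of_carrierAddCertificate_level
    (hJ : JetchevDivisibilityCarrierAdd)
    (hMcU : McCallum1991_padicValNat_card_sha_primary_add_le_of_globalDivisibility)
    (hGZK : rank_eq_analyticRank_of_analyticRank_le_one)
    (hKo : ∀ (N : ℕ) [NeZero N] (W : WeierstrassCurve ℚ) (K : Type) [Field K] [NumberField K],
      kolyvagin N W K)
    (hrec : ∀ (N : ℕ) [NeZero N] (W : WeierstrassCurve ℚ) (K : Type) [Field K] [NumberField K],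
      heegnerPointOfConductor_one_galoisConj N W K)
    (hD36 : ∀ (N : ℕ) [NeZero N] (W : WeierstrassCurve ℚ) (K : Type) [Field K] [NumberField K],
      phi_heegnerTau_mem_singularModuliField N W K)
    (hlev : ∀ {N : ℕ} [NeZero N], IsNewformOf.level_eq_conductorNorm (N := N))
    (W : WeierstrassCurve ℚ) [W.IsElliptic] [W.IsGloballyMinimal] (p : ℕ) [Fact p.Prime]
    {N : ℕ} [NeZero N] {K : Type} [Field K] [NumberField K] (hK : IsImaginaryQuadratic K)
    (hD3 : NumberField.discr K ≠ -3) (hD4 : NumberField.discr K ≠ -4)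
    (hH : SatisfiesHeegnerHypothesis N K) {P : (W.baseChange K).toAffine.Point}
    (hP : IsHeegnerPoint N W K P) (hnt : ¬ IsOfFinAddOrder P)
    (hp2 : p ≠ 2) (hng : ¬ W.HasGoodReductionAtPrime p) (hnm : ¬ W.HasMultiplicativeReductionAtPrime p)
    (htower : ∀ n : ℕ, W.HasSurjectiveModNGaloisRep (p ^ n : ℕ))
    (hI : padicValNat p (AddSubgroup.zmultiples P).index ≤
      padicValNat p ((W.baseChange ℚ_[p]).localTamagawaNumber ℤ_[p]))
    (hr : W.analyticRank ≤ 1) {s : ℚ} (hs : shaAn W = (s : ℂ)) (hv : padicValRat p s = 0) :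
    BSDp W p := by
  obtain ⟨Dt, -, -, -⟩ := id hP
  have hN : N = W.conductorNorm ℤ := hlev Dt.isNewformOf
  subst hN
  exact bsdp_of_carrierAddCertificate hJ hMcU hGZK W K (hKo _ W K) (hrec _ W K) (hD36 _ W K) hK hD3 hD4
    hH p hp2 hng hnm htower hP hnt hI hr hs hv

/-- **`BSD(E,3)` from the bucket-B-add certificate (carrier `3`, `E` ADDITIVE at `3` — Kodaira IV/IV*,
`c₃ = 3` on the register) with the `3`-adic tower DISCHARGED by ONE Frobenius witness modulo `9`**:
`ρ̄_{E,3}` onto (the register's galrep datum) and a good prime `ℓ ≡ 2` or `5 (mod 9)` with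
`a_ℓ ≡ 3` or `6 (mod 9)` give `ρ̄_{E,3^n}` onto for every `n` with NO hypothesis on the reduction at `3`
(`WeierstrassCurve.forall_hasSurjectiveModNGaloisRep_three_pow_of_frobenius`,
`Kato2004/ThreeAdicFrobeniusCertificate.lean`; such an `ℓ` exists by Čebotarev iff `ρ̄_{E,9}` is onto —
the pairs of exotic `3`-adic image keep the binder of `…_level`). Level-`N` row shape as in
`bsdp_of_carrierAddCertificate_level`. CONDITIONAL on the reading binder `hJ` and every published
binder. [cite: Jetchev2008, Cor. 1.5 (p. 812)] [cite: SerreAbelianLadic1968, Ch. IV §3.4 Lemma 3 (IV-23)]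
[cite: Elkies2006, Introduction (p. 1)] [cite: DiamondShurman2005, Thm. 8.8.1] -/
theorem bsdp_of_carrierAddCertificate_level_three_of_frobenius
    (hJ : JetchevDivisibilityCarrierAdd)
    (hMcU : McCallum1991_padicValNat_card_sha_primary_add_le_of_globalDivisibility)
    (hGZK : rank_eq_analyticRank_of_analyticRank_le_one)
    (hKo : ∀ (N : ℕ) [NeZero N] (W : WeierstrassCurve ℚ) (K : Type) [Field K] [NumberField K],
      kolyvagin N W K)
    (hrec : ∀ (N : ℕ) [NeZero N] (W : WeierstrassCurve ℚ) (K : Type) [Field K] [NumberField K],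
      heegnerPointOfConductor_one_galoisConj N W K)
    (hD36 : ∀ (N : ℕ) [NeZero N] (W : WeierstrassCurve ℚ) (K : Type) [Field K] [NumberField K],
      phi_heegnerTau_mem_singularModuliField N W K)
    (hlev : ∀ {N : ℕ} [NeZero N], IsNewformOf.level_eq_conductorNorm (N := N))
    (W : WeierstrassCurve ℚ) [W.IsElliptic] [W.IsGloballyMinimal]
    {N : ℕ} [NeZero N] {K : Type} [Field K] [NumberField K] (hK : IsImaginaryQuadratic K)
    (hD3 : NumberField.discr K ≠ -3) (hD4 : NumberField.discr K ≠ -4)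
    (hH : SatisfiesHeegnerHypothesis N K) {P : (W.baseChange K).toAffine.Point}
    (hP : IsHeegnerPoint N W K P) (hnt : ¬ IsOfFinAddOrder P)
    (hng : ¬ W.HasGoodReductionAtPrime 3) (hnm : ¬ W.HasMultiplicativeReductionAtPrime 3)
    (hsurj : W.HasSurjectiveModNGaloisRep 3)
    (ℓ : ℕ) [Fact ℓ.Prime] (hgood : W.HasGoodReductionAtPrime ℓ) (hℓ9 : ℓ % 9 = 2 ∨ ℓ % 9 = 5)
    (ha9 : W.frobeniusTrace ℓ % 9 = 3 ∨ W.frobeniusTrace ℓ % 9 = 6)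
    (hI : padicValNat 3 (AddSubgroup.zmultiples P).index ≤
      padicValNat 3 ((W.baseChange ℚ_[3]).localTamagawaNumber ℤ_[3]))
    (hr : W.analyticRank ≤ 1) {s : ℚ} (hs : shaAn W = (s : ℂ)) (hv : padicValRat 3 s = 0) :
    BSDp W 3 :=
  bsdp_of_carrierAddCertificate_level hJ hMcU hGZK hKo hrec hD36 hlev W 3 hK hD3 hD4 hH hP hnt
    (by norm_num) hng hnm (W.forall_hasSurjectiveModNGaloisRep_three_pow_of_frobenius hsurj ℓ hgood hℓ9 ha9)
    hI hr hs hv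

end Summit.BirchSwinnertonDyer.Rank1Residual.JET

end
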